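import Summits.Schanuel.Schanuel.Theorems.ZilberEacDegenerateDirectionDensity
import Summits.Schanuel.Schanuel.Theorems.ZilberEacBottomEdgeReduction
import HarnessLib

/-!
# The exponential-polynomial regime, CXV (b): exponential points and density FROM A BOTTOM EDGE
# of the Newton polygon (minimal hypotheses on the degenerate part)

HONEST FRAMING.  Cell `pub-schanuel` (Zilber's Exponential-Algebraic Closedness, case ladder;
host summit Schanuel), seat 2, gen 34.  Final form of the degenerate-direction engine of this
generation.  The degenerate part `G₀` of the fibre relation `G ∈ ℂ[x₀, x₁, y₁][y₀]` is only
required to agree with `G(x, 0; y₀)` ON THE CURVE `F = 0` and to have two coefficients not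
divisible by `F` — equivalently `G₀ mod F` has a nonzero root, i.e. the Newton polygon of `G` in
`(y₀, y₁)` over the function field of the curve has a bottom EDGE.  The reduction
`G₀ ≡ y₀^m R (mod F)` of file CXV (a) supplies a polynomial `T = y₀^m R` with `F ∤ lc(T)` and a
Puiseux root; the proofs of files CX (c) / CXI go through with `T` in place of `G₀`:
**`exists_expPoints_bottomEdge`**, **`unprojectedDense_bottomEdge`**.  Mantova–Masser's question
(PLMS 2024 §1 p. 5) stays OPEN; EC(3,2) OPEN; NOT Schanuel's conjecture (neither used nor implied);
EAC ⇏ SC.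
-/

noncomputable section

open Filter Topology Metric Complex Polynomial
open Literature.NumberTheory.Transcendental Literature.ModelTheory.Zilber
open Literature.ModelTheory.ExponentialFields

set_option linter.dupNamespace false

namespace Summit.Schanuel.Schanuel.Theorems

section BottomEdgePoints

variable (F : ℂ[X][X])

/-- **EXPONENTIAL POINTS IN A DEGENERATE DIRECTION FROM A BOTTOM EDGE.**  As
`exists_expPoints_degenerateDirection` (file CX (c)) with the MINIMAL hypothesis on the degenerate
part: `G₀ ∈ ℂ[x₀][x₁][y₀]` agrees with `G(x, 0; y₀)` ON THE CURVE and has two coefficients not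
divisible by `F` (the Newton polygon of `G` has a bottom edge); `F` irreducible, place
`x₀ = s^{-k}`, `x₁ = Φ(s)s^{-M}` (`M ≥ 1`), `z^k = 2πi`, `Re(Φ(0)z^M) < 0` ⟹ exponential points
`(x(p_j), e^{x(p_j)})` on `{F = 0, G(x, y₁; y₀) = 0}` with `Re x₁ ≤ −c|p_j|^{-M}`,
`|x₁| ≤ C|p_j|^{-M}`. [cite: MantovaMasser2023, §1 Further remarks, p. 5 (the exponential-polynomial
regime of the question, open in general)] (new) -/
theorem exists_expPoints_bottomEdge (hFirr : Irreducible F) (hn : 1 ≤ F.natDegree)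
    {k : ℕ} (hk : 1 ≤ k) {M : ℕ} (hM : 1 ≤ M) {Φ : ℂ → ℂ} (hΦan : AnalyticAt ℂ Φ 0)
    (hplace : ∀ᶠ s in 𝓝[≠] (0 : ℂ),
      (F.map (Polynomial.evalRingHom (s ^ k)⁻¹)).eval (Φ s * (s ^ M)⁻¹) = 0)
    {z : ℂ} (hz : z ^ k = 2 * Real.pi * I) (hdir : (Φ 0 * z ^ M).re < 0)
    (G : Polynomial (MvPolynomial (Fin 3) ℂ)) (G₀ : Polynomial ℂ[X][X])
    (hG₀ : ∀ x₀ x₁ y : ℂ, (F.map (Polynomial.evalRingHom x₀)).eval x₁ = 0 →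
      (G₀.map (Polynomial.eval₂RingHom (Polynomial.evalRingHom x₀) x₁)).eval y =
        (G.map (MvPolynomial.eval ![x₀, x₁, 0])).eval y)
    (h2 : ∃ i j, i < j ∧ ¬ F ∣ G₀.coeff i ∧ ¬ F ∣ G₀.coeff j) :
    ∃ (p : ℕ → ℂ) (c : ℝ), 0 < c ∧ (∀ j, p j ≠ 0) ∧ Tendsto p atTop (𝓝 0) ∧
      (∀ j, (F.map (Polynomial.evalRingHom (p j ^ k)⁻¹)).eval (Φ (p j) * (p j ^ M)⁻¹) = 0) ∧
      (∀ j, (Φ (p j) * (p j ^ M)⁻¹).re ≤ -c * ‖p j‖⁻¹ ^ M) ∧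
      (∀ j, ‖Φ (p j) * (p j ^ M)⁻¹‖ ≤ (‖Φ 0‖ + 1) * ‖p j‖⁻¹ ^ M) ∧
      ∀ j, (G.map (MvPolynomial.eval ![(p j ^ k)⁻¹, Φ (p j) * (p j ^ M)⁻¹,
        Complex.exp (Φ (p j) * (p j ^ M)⁻¹)])).eval (Complex.exp ((p j ^ k)⁻¹)) = 0 := by
  classical
  have hk0 : k ≠ 0 := by omega
  have h2πI : (2 * Real.pi * I : ℂ) ≠ 0 := by simp [Real.pi_ne_zero, Complex.I_ne_zero]
  have hz0 : z ≠ 0 := by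
    rintro rfl
    rw [zero_pow hk0] at hz
    exact h2πI hz.symm
  -- Step 1: the bottom-edge reduction `T ≡ G₀ (mod F)` and its Puiseux root (file CXV (a))
  obtain ⟨T, e, L, ψ, hTtop, hTdiff, he, hψan, hψ0, hroot⟩ :=
    exists_bottomEdge_root F hFirr hn hk M hΦan hplace h2
  -- Step 2: the edge data of `T` (file CX (a))
  obtain ⟨ν, α, hα, hEψ, hEne, hedge⟩ :=
    exists_edgeData F hFirr hn hk M hΦan hplace T hTtop he L hψan hroot
  -- Step 3: the direction in the ramified parameter: `ζ^e = z`, `ζ^{ek} = 2πi`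
  obtain ⟨ζ, hζ⟩ := IsAlgClosed.exists_pow_nat_eq z (by omega : 0 < e)
  have hζk : ζ ^ (e * k) = 2 * Real.pi * I := by rw [pow_mul, hζ, hz]
  have hek : 1 ≤ e * k := Nat.one_le_iff_ne_zero.2 (Nat.mul_ne_zero (by omega) hk0)
  -- Step 4: the perturbation, holomorphic and small in the sector (file CX (b))
  obtain ⟨ρ, hρ0, hΦd⟩ : ∃ ρ > 0, ∀ w : ℂ, ‖w‖ < ρ → DifferentiableAt ℂ Φ w := by
    obtain ⟨ρ, hρ0, h⟩ := Metric.eventually_nhds_iff.1 hΦan.eventually_analyticAt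
    exact ⟨ρ, hρ0, fun w hw => (h (by rwa [dist_zero_right])).differentiableAt⟩
  have hPd : ∀ σ Y : ℂ, σ ≠ 0 → ‖σ‖ < min 1 ρ →
      DifferentiableAt ℂ (fun q : ℂ × ℂ => (q.1 ^ ν)⁻¹ *
        ((G.map (MvPolynomial.eval ![((q.1 ^ e) ^ k)⁻¹, Φ (q.1 ^ e) * ((q.1 ^ e) ^ M)⁻¹,
            Complex.exp (Φ (q.1 ^ e) * ((q.1 ^ e) ^ M)⁻¹)])).eval (q.1 ^ L * q.2) -
         (G.map (MvPolynomial.eval ![((q.1 ^ e) ^ k)⁻¹, Φ (q.1 ^ e) * ((q.1 ^ e) ^ M)⁻¹, 0])).eval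
            (q.1 ^ L * q.2))) (σ, Y) :=
    fun σ Y hσ0 hσ => degeneratePerturbation_differentiableAt hΦd e k M he G ν L hσ0
      (hσ.trans_le (min_le_left _ _)) (hσ.trans_le (min_le_right _ _)) Y
  have hPs : ∀ R > 0, ∀ ε > 0, ∃ δ > 0, ∃ η > 0, ∀ (t : ℝ) (u Y : ℂ), 0 < t → t < δ →
      ‖u - 1‖ < η → ‖Y‖ ≤ R →
      ‖(fun σ Y : ℂ => (σ ^ ν)⁻¹ *
        ((G.map (MvPolynomial.eval ![((σ ^ e) ^ k)⁻¹, Φ (σ ^ e) * ((σ ^ e) ^ M)⁻¹,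
            Complex.exp (Φ (σ ^ e) * ((σ ^ e) ^ M)⁻¹)])).eval (σ ^ L * Y) -
         (G.map (MvPolynomial.eval ![((σ ^ e) ^ k)⁻¹, Φ (σ ^ e) * ((σ ^ e) ^ M)⁻¹, 0])).eval
            (σ ^ L * Y))) (ζ⁻¹ * t * u) Y‖ < ε := by
    intro R hR ε hε
    obtain ⟨δ, hδ, η, hη, h⟩ :=
      degeneratePerturbation_small (k := k) hΦan.continuousAt he hM hζ hz0 hdir G ν L R hR ε hε
    exact ⟨δ, hδ, η, hη, fun t u Y ht htδ hu hY => h t u Y _ ht htδ hu hY rfl⟩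
  -- Step 5: the abstract perturbation theorem (file CVIII (b))
  obtain ⟨N₀, u, s, -, hu1, -, hs, hs0, hs0', hsol⟩ :=
    exists_expPoints_perturbedEdge (P := fun σ Y : ℂ => (σ ^ ν)⁻¹ *
        ((G.map (MvPolynomial.eval ![((σ ^ e) ^ k)⁻¹, Φ (σ ^ e) * ((σ ^ e) ^ M)⁻¹,
            Complex.exp (Φ (σ ^ e) * ((σ ^ e) ^ M)⁻¹)])).eval (σ ^ L * Y) -
         (G.map (MvPolynomial.eval ![((σ ^ e) ^ k)⁻¹, Φ (σ ^ e) * ((σ ^ e) ^ M)⁻¹, 0])).eval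
            (σ ^ L * Y)))
      hek L hζk T.natDegree hα hψ0 hEψ hEne (lt_min one_pos hρ0) hPd hPs
  -- Step 6: thresholds along the sequence
  have hsW : Tendsto s atTop (𝓝[≠] (0 : ℂ)) :=
    tendsto_nhdsWithin_iff.2 ⟨hs0', Eventually.of_forall hs0⟩
  have hseW : Tendsto (fun j => s j ^ e) atTop (𝓝[≠] (0 : ℂ)) :=
    (tendsto_pow_puncturedNhds_zero e he).comp hsW
  have he0 : (0 : ℂ) ^ e = 0 := zero_pow (by omega)
  have hΦc' : ContinuousAt (fun σ : ℂ => Φ (σ ^ e)) 0 :=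
    hΦan.continuousAt.comp_of_eq (continuous_pow e).continuousAt (by simp [he0])
  have hdir' : ((fun σ : ℂ => Φ (σ ^ e)) 0 * z ^ M).re < 0 := by
    simp only [he0]
    exact hdir
  obtain ⟨c, hc, δ₁, hδ₁, η₁, hη₁, hdirc⟩ := exists_direction_const hΦc' (z ^ M) (e * M) hdir'
  have hΦb : ∀ᶠ j in atTop, ‖Φ (s j ^ e)‖ ≤ ‖Φ 0‖ + 1 := by
    have h1 : Tendsto (fun j => Φ (s j ^ e)) atTop (𝓝 (Φ 0)) :=
      hΦan.continuousAt.tendsto.comp (tendsto_nhds_of_tendsto_nhdsWithin hseW)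
    filter_upwards [(Metric.tendsto_nhds.1 h1) 1 one_pos] with j hj
    rw [dist_eq_norm] at hj
    linarith [norm_le_norm_add_norm_sub' (Φ (s j ^ e)) (Φ 0)]
  set tt : ℕ → ℝ := fun j => Real.exp (-(Real.log ((N₀ + j : ℕ) : ℝ)) / ((e * k : ℕ) : ℝ))
    with htt
  have htt0 : ∀ j, 0 < tt j := fun j => Real.exp_pos _
  have hst : ∀ j, s j = ζ⁻¹ * (tt j : ℂ) * u j := by
    intro j
    rw [hs j, htt]
    simp only [Complex.ofReal_exp]
    push_cast
    ring_nf
  have hularge : ∀ᶠ j in atTop, ‖u j - 1‖ < min η₁ (1 / 2) := by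
    filter_upwards [(Metric.tendsto_nhds.1 hu1) (min η₁ (1 / 2)) (lt_min hη₁ (by norm_num))]
      with j hj
    rwa [dist_eq_norm] at hj
  have hsδ : ∀ᶠ j in atTop, ‖s j‖ < δ₁ := by
    filter_upwards [(Metric.tendsto_nhds.1 hs0') δ₁ hδ₁] with j hj
    rwa [dist_zero_right] at hj
  obtain ⟨J₀, hJ₀⟩ := Filter.eventually_atTop.1
    ((hsW.eventually hedge).and ((hseW.eventually hplace).and (hΦb.and (hularge.and hsδ))))
  have hshift : Tendsto (fun j => J₀ + j) atTop atTop :=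
    (tendsto_add_atTop_nat J₀).congr fun j => Nat.add_comm j J₀
  -- Step 7: the sequence `p_j = s_{J₀ + j}^e`
  refine ⟨fun j => s (J₀ + j) ^ e, c * (‖ζ⁻¹‖ / 2) ^ (e * M), ?_, fun j => pow_ne_zero _ (hs0 _),
    ?_, fun j => (hJ₀ (J₀ + j) (Nat.le_add_right _ _)).2.1, ?_, ?_, ?_⟩
  · have hζ0 : ζ ≠ 0 := by
      rintro rfl
      rw [zero_pow (by omega)] at hζ
      exact hz0 hζ.symm
    have : 0 < ‖ζ⁻¹‖ := norm_pos_iff.2 (inv_ne_zero hζ0)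
    positivity
  · exact tendsto_nhds_of_tendsto_nhdsWithin (hseW.comp hshift)
  · -- the direction: `Re x₁ ≤ -c' |p|^{-M}`
    intro j
    obtain ⟨-, -, -, huj, hsj⟩ := hJ₀ (J₀ + j) (Nat.le_add_right _ _)
    have hre := sector_re_le (M := M) hζ hdirc (htt0 (J₀ + j)) (hst (J₀ + j)) hsj
      (huj.trans_le (min_le_left _ _))
    obtain ⟨hra, -⟩ := sector_norm_bounds (htt0 _) (hst (J₀ + j)) (huj.trans_le (min_le_right _ _))
    have hs0j : 0 < ‖s (J₀ + j)‖ := norm_pos_iff.2 (hs0 _)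
    have h1 : ‖ζ⁻¹‖ / 2 * ‖s (J₀ + j)‖⁻¹ ≤ (tt (J₀ + j))⁻¹ := by
      rw [← div_eq_mul_inv, div_le_iff₀ hs0j]
      calc ‖ζ⁻¹‖ / 2 = (tt (J₀ + j))⁻¹ * (‖ζ⁻¹‖ / 2 * tt (J₀ + j)) := by
            field_simp [(htt0 (J₀ + j)).ne']
        _ ≤ (tt (J₀ + j))⁻¹ * ‖s (J₀ + j)‖ :=
            mul_le_mul_of_nonneg_left hra (inv_pos.2 (htt0 _)).le
    have h2 : (‖ζ⁻¹‖ / 2) ^ (e * M) * ‖s (J₀ + j)‖⁻¹ ^ (e * M) ≤ (tt (J₀ + j))⁻¹ ^ (e * M) := by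
      rw [← mul_pow]
      exact pow_le_pow_left₀ (by positivity) h1 _
    have h3 := mul_le_mul_of_nonneg_left h2 hc.le
    have hR : -(c * (‖ζ⁻¹‖ / 2) ^ (e * M)) * ‖s (J₀ + j) ^ e‖⁻¹ ^ M =
        -(c * ((‖ζ⁻¹‖ / 2) ^ (e * M) * ‖s (J₀ + j)‖⁻¹ ^ (e * M))) := by
      rw [norm_pow]
      ring
    show (Φ (s (J₀ + j) ^ e) * ((s (J₀ + j) ^ e) ^ M)⁻¹).re ≤
      -(c * (‖ζ⁻¹‖ / 2) ^ (e * M)) * ‖s (J₀ + j) ^ e‖⁻¹ ^ M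
    rw [hR]
    linarith
  · -- the size: `|x₁| ≤ (|Φ(0)| + 1) |p|^{-M}`
    intro j
    obtain ⟨-, -, hΦj, -, -⟩ := hJ₀ (J₀ + j) (Nat.le_add_right _ _)
    show ‖Φ (s (J₀ + j) ^ e) * ((s (J₀ + j) ^ e) ^ M)⁻¹‖ ≤ (‖Φ 0‖ + 1) * ‖s (J₀ + j) ^ e‖⁻¹ ^ M
    rw [norm_mul, norm_inv, norm_pow, ← inv_pow]
    exact mul_le_mul_of_nonneg_right hΦj (by positivity)
  · -- the equation
    intro j
    obtain ⟨hedgej, hFj, -, -, -⟩ := hJ₀ (J₀ + j) (Nat.le_add_right _ _)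
    have hσ0 : s (J₀ + j) ≠ 0 := hs0 _
    have hsolj := hsol (J₀ + j)
    have hYfull : s (J₀ + j) ^ L * (Complex.exp ((s (J₀ + j) ^ (e * k))⁻¹) *
        (s (J₀ + j) ^ L)⁻¹) = Complex.exp (((s (J₀ + j) ^ e) ^ k)⁻¹) := by
      rw [← pow_mul]
      field_simp
    have hedgeY := hedgej (Complex.exp ((s (J₀ + j) ^ (e * k))⁻¹) * (s (J₀ + j) ^ L)⁻¹)
    rw [← eval_eq_of_forall_dvd_sub F hTdiff hFj, hG₀ _ _ _ hFj, hYfull] at hedgeY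
    have hν0 : s (J₀ + j) ^ ν ≠ 0 := zpow_ne_zero _ hσ0
    -- multiply the solved relation by `σ^ν`
    have key := congrArg (fun w => s (J₀ + j) ^ ν * w) hsolj
    simp only [mul_zero, mul_add, hYfull] at key
    rw [← hedgeY, ← mul_assoc, mul_inv_cancel₀ hν0, one_mul, add_sub_cancel] at key
    simpa using key


/-- **DENSITY FROM A BOTTOM EDGE (S-form).**  As `unprojectedDense_degenerateDirection` (file
CXI) with the minimal hypothesis on the degenerate part (`G₀ ≡ G(x, 0; y₀)` on the curve, two
coefficients not divisible by `F`): every irreducible closed `S ⊆ ℂ² × ℂ²` of dimension `≤ 2`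
containing, for small `s ≠ 0`, every point `(s^{-k}, Φ(s)s^{-M}, y, e^{Φ(s)s^{-M}})` with
`y ≠ 0` and `G(x(s), e^{x₁(s)}; y) = 0` has Zariski-dense exponential points.
[cite: MantovaMasser2023, §1 Further remarks, p. 5 (the question, open in general)] (new) -/
theorem unprojectedDense_bottomEdge (hFirr : Irreducible F) (hn : 1 ≤ F.natDegree)
    {k : ℕ} (hk : 1 ≤ k) {M : ℕ} (hM : 1 ≤ M) {Φ : ℂ → ℂ} (hΦan : AnalyticAt ℂ Φ 0)
    (hplace : ∀ᶠ s in 𝓝[≠] (0 : ℂ),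
      (F.map (Polynomial.evalRingHom (s ^ k)⁻¹)).eval (Φ s * (s ^ M)⁻¹) = 0)
    {z : ℂ} (hz : z ^ k = 2 * Real.pi * I) (hdir : (Φ 0 * z ^ M).re < 0)
    (G : Polynomial (MvPolynomial (Fin 3) ℂ)) (G₀ : Polynomial ℂ[X][X])
    (hG₀ : ∀ x₀ x₁ y : ℂ, (F.map (Polynomial.evalRingHom x₀)).eval x₁ = 0 →
      (G₀.map (Polynomial.eval₂RingHom (Polynomial.evalRingHom x₀) x₁)).eval y =
        (G.map (MvPolynomial.eval ![x₀, x₁, 0])).eval y)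
    (h2 : ∃ i j, i < j ∧ ¬ F ∣ G₀.coeff i ∧ ¬ F ∣ G₀.coeff j)
    {S : Set (Fin 2 ⊕ Fin 2 → ℂ)} (hS : IsIrreducibleClosed ℂ S) (hdim : zariskiDim ℂ S ≤ (2 : ℕ))
    (hsub : ∀ᶠ s in 𝓝[≠] (0 : ℂ), ∀ y : ℂ, y ≠ 0 →
      (G.map (MvPolynomial.eval ![(s ^ k)⁻¹, Φ s * (s ^ M)⁻¹,
        Complex.exp (Φ s * (s ^ M)⁻¹)])).eval y = 0 →
      (Sum.elim ![(s ^ k)⁻¹, Φ s * (s ^ M)⁻¹] ![y, Complex.exp (Φ s * (s ^ M)⁻¹)] :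
        Fin 2 ⊕ Fin 2 → ℂ) ∈ S) :
    UnprojectedDense S := by
  classical
  obtain ⟨p, c, hc, hp0, hp, hF, hre, hnorm, hG⟩ := exists_expPoints_bottomEdge F hFirr
    hn hk hM hΦan hplace hz hdir G G₀ hG₀ h2
  have hpW : Tendsto p atTop (𝓝[≠] (0 : ℂ)) :=
    tendsto_nhdsWithin_iff.2 ⟨hp, Eventually.of_forall hp0⟩
  obtain ⟨J₀, hJ₀⟩ := Filter.eventually_atTop.1 (hpW.eventually hsub)
  -- the exponential points
  set P : ℕ → Fin 2 ⊕ Fin 2 → ℂ := fun m =>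
    Sum.elim ![(p (J₀ + m) ^ k)⁻¹, Φ (p (J₀ + m)) * (p (J₀ + m) ^ M)⁻¹]
      ![Complex.exp ((p (J₀ + m) ^ k)⁻¹), Complex.exp (Φ (p (J₀ + m)) * (p (J₀ + m) ^ M)⁻¹)]
    with hPdef
  have hPS : ∀ m, P m ∈ S := fun m =>
    hJ₀ (J₀ + m) (Nat.le_add_right _ _) _ (Complex.exp_ne_zero _) (hG (J₀ + m))
  have hPΓ : ∀ m, P m ∈ expGraph ℂ 2 := by
    intro m
    rw [mem_expGraph_iff]
    intro i
    rw [Literature.ModelTheory.ExponentialFields.ExponentialRing.complex_exp_eq]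
    fin_cases i <;> simp [hPdef]
  -- growth of `x₁`
  set Lg : ℕ → ℝ := fun m => c * ‖p (J₀ + m)‖⁻¹ ^ M with hLg
  have hpJ : Tendsto (fun m => p (J₀ + m)) atTop (𝓝 0) :=
    hp.comp ((tendsto_add_atTop_nat J₀).congr fun m => Nat.add_comm m J₀)
  have hLgtop : Tendsto Lg atTop atTop := by
    have h1 : Tendsto (fun m => ‖p (J₀ + m)‖⁻¹) atTop atTop := by
      have h2 : Tendsto (fun m => ‖p (J₀ + m)‖) atTop (𝓝[>] 0) :=
        tendsto_nhdsWithin_iff.2 ⟨by simpa using hpJ.norm,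
          Eventually.of_forall fun m => norm_pos_iff.2 (hp0 _)⟩
      exact tendsto_inv_nhdsGT_zero.comp h2
    exact (tendsto_pow_atTop (by omega : M ≠ 0) |>.comp h1).const_mul_atTop hc
  have hgr : Tendsto (fun m => |(P m (Sum.inl 1)).re| / Real.log (2 + ‖P m (Sum.inl 1)‖))
      atTop atTop := by
    refine tendsto_abs_re_div_log_of_escape hLgtop (A := (‖Φ 0‖ + 1) / c) (fun m => ?_)
      (fun m => ?_)
    · simp only [hPdef, Sum.elim_inl, Matrix.cons_val_one, Matrix.cons_val_zero, hLg]
      have := hre (J₀ + m)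
      linarith
    · simp only [hPdef, Sum.elim_inl, Matrix.cons_val_one, Matrix.cons_val_zero, hLg]
      have := hnorm (J₀ + m)
      rw [show (‖Φ 0‖ + 1) / c * (c * ‖p (J₀ + m)‖⁻¹ ^ M) = (‖Φ 0‖ + 1) * ‖p (J₀ + m)‖⁻¹ ^ M by
        field_simp]
      exact this
  exact unprojectedDense_of_growth hS hdim 1 hPS hPΓ hgr


end BottomEdgePoints

end Summit.Schanuel.Schanuel.Theorems

end
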